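import Literature.AnabelianGeometry.EtaleTheta.SettingModelChiInvClauses
import Literature.AnabelianGeometry.EtaleTheta.SettingModelTateInversionTheta
import HarnessLib

/-!
# GAP row G-L2t2-2 (`hιF`, the COCYCLE-level inversion datum of the bi-theta case) HOLDS at both χ-models, with `a = 1`
# (proof-only NV)

Mochizuki, *The étale theta function …*, Publ. RIMS **45** (2009) [EtTh], Prop. 1.4 (ii) p. 22 (`Θ̈(−Ü) = −Θ̈(Ü)`,
`Θ̈(Ü⁻¹) = −Θ̈(Ü)`), Thm. 1.6 (iii) p. 24, Prop. 2.14 (iii) p. 50 [cite: MochizukiEtTh2009, Thm 1.6 (iii) p.24].  abc-iut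
cell, layer L2, prover abc-iut-L2-d1 (gen 5); PROOF-ONLY NV for abc-iut-L2-t2's GAP row **G-L2t2-2** (13:20Z): the binder
`hιF : ∃ F hF a, ContH1.mk F hF = E.etaDd ∧ a ∈ l·Δ_Θ ∧ transportFun c h F = fun g => F g * (conj_{θ g} a · a⁻¹)` of
`Discharge/Sec2Prop214iiiBiInversionOfModel` («the good lift of the inversion carries the étale theta COCYCLE to itself up
to an `l·Δ_Θ`-valued coboundary»; sharpening of the class-level G-L2t2-1).  At the χ-models the inversion of record fixes
the model cocycle ON THE NOSE (this seat's `transportFun_thetaCocycleχ`, p443781, stage 1; `transportFun_zFunχq_inversionχq`,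
p446839, stage 2), so `hιF` holds with `a := 1`.  The stage-1 instance for the quotient-map companion is abc-iut-L2-t2's
`hιF_modelχ` (`Discharge/Sec2Prop214iiiBiInversionModelChi`, p447858, over this seat's p440780); here:
* `hιF_modelχ_of_companion` — stage 1 for EVERY theta companion `c` of the twisted inversion (`h := IsInversionAut.thm16i`),
  `E := etaleThetaDataχSec p (etaDdχ p)`, every `l`;
* **`hιF_modelχq`** — at `modelχq p i j hj` for the class of record `etaDdχq` (any `E` with `E.etaDd = etaDdχq`), the
  cocycle-corrected inversion, every companion, every `l`.
SEMI-SYNTHETIC MODELS, consistency evidence only; nothing of [EtTh] asserted; no side taken on [IUTchIII] Cor. 3.12.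
-/

noncomputable section

namespace Literature.AnabelianGeometry.EtaleTheta.SettingModel

open Literature.AnabelianGeometry.SemiGraphs _root_.Function

variable (p : ℕ) [Fact p.Prime]

/-- **G-L2t2-2 (`hιF`) at the χ-model with `a := 1`, for EVERY theta companion** (the quotient-map companion case is
abc-iut-L2-t2's `hιF_modelχ`): the model theta cocycle `F` (class `η̈^Θ = etaDdχ`) is carried
to ITSELF by the transport `ι^Θ ∘ F ∘ ι⁻¹` along the twisted inversion and any theta companion — the coboundary factor is
`conj(1)·1⁻¹ = 1 ∈ l·Δ_Θ`. [cite: MochizukiEtTh2009, Thm 1.6 (iii) p.24] -/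
theorem hιF_modelχ_of_companion (l : ℕ+)
    (cι : ThetaSetting.ThetaCompanion (Dα := ThetaSetting.modelχ p) (Dβ := ThetaSetting.modelχ p)
      (twistedInversionTop (chi p) (isInducing_leftRightχ p))) :
    ∃ (F : ↥(ThetaSetting.modelχ p).GtpYdd → ↥(ThetaSetting.modelχ p).DeltaTheta)
      (hF : F ∈ contCocycles (ThetaSetting.modelχ p).toTheta (ThetaSetting.modelχ p).DeltaTheta
        (ThetaSetting.modelχ p).GtpYdd)
      (a : ↥(ThetaSetting.modelχ p).DeltaTheta),
      ContH1.mk F hF = (etaleThetaDataχSec p (etaDdχ p)).etaDd ∧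
        (a : (ThetaSetting.modelχ p).GtpTheta) ∈ (ThetaSetting.modelχ p).lDeltaTheta l ∧
        ThetaSetting.transportFun cι (isInversionAut_twistedInversion_modelχ p).thm16i F =
          fun g => F g * (MulAut.conjNormal ((ThetaSetting.modelχ p).toTheta (g : PiTpχ p)) a * a⁻¹) :=
  ⟨fun g : ↥(ThetaSetting.modelχ p).GtpYdd => thetaCocycleFunχ p ⟨g, (ThetaSetting.modelχ p).GtpYdd_le_GtpY g.2⟩,
    (ContH1.resCocycle (ThetaSetting.modelχ p).toTheta (ThetaSetting.modelχ p).DeltaTheta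
      (ThetaSetting.modelχ p).GtpYdd_le_GtpY (thetaCocycleχ p)).2,
    1, (etaDdχ_eq_mk p).symm, Subgroup.one_mem _, by
      rw [transportFun_thetaCocycleχ p cι]
      funext g
      rw [map_one, inv_one, mul_one, mul_one]⟩

/-- **G-L2t2-2 (`hιF`) HOLDS at the stage-2 model with `a := 1`** for the class of record `η̈♯ = etaDdχq` (abc-iut-L2-t6's
`z`-cocycle is carried to itself by the transport along the cocycle-corrected inversion and any theta companion), for
every étale-theta datum `E` with `E.etaDd = etaDdχq p i j hj`. [cite: MochizukiEtTh2009, Thm 1.6 (iii) p.24] -/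
theorem hιF_modelχq (i j : ℤ) (hj : Even j) (l : ℕ+)
    (cι : ThetaSetting.ThetaCompanion (Dα := ThetaSetting.modelχq p i j hj) (Dβ := ThetaSetting.modelχq p i j hj)
      (inversionχq p i j))
    (E : (ThetaSetting.modelχq p i j hj).EtaleThetaData) (hE : E.etaDd = etaDdχq p i j hj) :
    ∃ (F : ↥(ThetaSetting.modelχq p i j hj).GtpYdd → ↥(ThetaSetting.modelχq p i j hj).DeltaTheta)
      (hF : F ∈ contCocycles (ThetaSetting.modelχq p i j hj).toTheta (ThetaSetting.modelχq p i j hj).DeltaTheta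
        (ThetaSetting.modelχq p i j hj).GtpYdd)
      (a : ↥(ThetaSetting.modelχq p i j hj).DeltaTheta),
      ContH1.mk F hF = E.etaDd ∧
        (a : (ThetaSetting.modelχq p i j hj).GtpTheta) ∈ (ThetaSetting.modelχq p i j hj).lDeltaTheta l ∧
        ThetaSetting.transportFun cι (isInversionAut_inversionχq p i j hj).thm16i F =
          fun g => F g * (MulAut.conjNormal ((ThetaSetting.modelχq p i j hj).toTheta (g : PiTpχq p i j)) a * a⁻¹) :=
  ⟨fun x : ↥(ThetaSetting.modelχq p i j hj).GtpYdd =>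
      zFunχq p i j hj _ (Subgroup.map_mono (ThetaSetting.modelχq p i j hj).GtpYdd_le_GtpY)
        ⟨(ThetaSetting.modelχq p i j hj).toTheta (x : PiTpχq p i j), ⟨x.1, x.2, rfl⟩⟩,
    (ContH1.inflCocycle (ThetaSetting.modelχq p i j hj).DeltaTheta (ThetaSetting.modelχq p i j hj).toTheta
      (ThetaSetting.modelχq p i j hj).continuous_toTheta le_rfl
      ⟨zFunχq p i j hj _ (Subgroup.map_mono (ThetaSetting.modelχq p i j hj).GtpYdd_le_GtpY),
        zFunχq_mem p i j hj _ (Subgroup.map_mono (ThetaSetting.modelχq p i j hj).GtpYdd_le_GtpY)⟩).2,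
    1, by rw [hE, etaDdχq_eq_mk], Subgroup.one_mem _, by
      rw [transportFun_zFunχq_inversionχq p i j hj cι]
      funext g
      rw [map_one, inv_one, mul_one, mul_one]⟩

/-- **Census form**: at SOME Theta setting of [EtTh] origin, with étale theta data of NON-TRIVIAL class, an inversion
automorphism `ι` (Prop. 1.5 (iii)) with a theta companion carries a cocycle of `η̈^Θ` to itself up to an `l·Δ_Θ`-valued
coboundary — the binder `hιF` of G-L2t2-2 is INHABITED (χ-model, `a = 1`). [cite: MochizukiEtTh2009, Thm 1.6 (iii) p.24] -/
theorem _root_.Literature.AnabelianGeometry.EtaleTheta.ThetaSetting.exists_isEtThOrigin_hιF (l : ℕ+) :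
    ∃ (D : ThetaSetting p) (E : D.EtaleThetaData) (ι : D.PiTemp ≃ₜ* D.PiTemp) (hι : D.IsInversionAut ι)
      (c : ThetaSetting.ThetaCompanion ι), D.IsEtThOrigin ∧ E.etaDd ≠ 1 ∧
      ∃ (F : ↥D.GtpYdd → ↥D.DeltaTheta) (hF : F ∈ contCocycles D.toTheta D.DeltaTheta D.GtpYdd) (a : ↥D.DeltaTheta),
        ContH1.mk F hF = E.etaDd ∧ (a : D.GtpTheta) ∈ D.lDeltaTheta l ∧
          ThetaSetting.transportFun c hι.thm16i F = fun g => F g * (MulAut.conjNormal (D.toTheta (g : D.PiTemp)) a * a⁻¹) :=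
  ⟨ThetaSetting.modelχ p, etaleThetaDataχSec p (etaDdχ p), twistedInversionTop (chi p) (isInducing_leftRightχ p),
    isInversionAut_twistedInversion_modelχ p,
    (ThetaSetting.modelχ p).thetaCompanionOfAut (twistedInversionTop (chi p) (isInducing_leftRightχ p))
      (map_deltaTemp_twistedInversion_modelχ p) (isQuotientMap_toTheta_modelχ p),
    ThetaSetting.modelχ_isEtThOrigin p, etaDd_etaleThetaDataχSec_etaDdχ_ne_one p, hιF_modelχ_of_companion p l _⟩

end Literature.AnabelianGeometry.EtaleTheta.SettingModel

end
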